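import Literature.Algebra.Lie.LefschetzPoincareTypeWeilFormSignature
import Literature.Algebra.Lie.LefschetzModuleWeylOperatorDegreeZero
import Literature.Algebra.Lie.LefschetzModuleWeylOperatorSelfAdjoint
import HarnessLib

/-!
# The Weil form on the middle degree through the Weyl element `w`: under the Hodge–Riemann sign rule `ψ(x, Cy)` is `ε`-DEFINITE on the
# `w`-invariants `M₀ ∩ ker(w − 1)` and `(−ε)`-definite on the anti-invariants `M₀ ∩ ker(w + 1)`, these are orthogonal, and conversely;
# `b^±(ψ_C|_{M₀}) = dim(M₀ ∩ ker(w ∓ ε))` and the index is `b⁺ − b⁻ = ε · tr(w | M₀)` (André: `w ↦ ± *_H`; Beauville: `ℱ = w`)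

[topic Algebra/Lie]

Topic `Literature/Algebra/Lie` (namespace `Literature.Algebra.Lie`, `….HasLefschetzProperty`).  Lane `lit-hodgefound` (Track 2 foundations library), prover seat
`lit-hodgefound-p09` (generation 61, row g61-#7).  It joins two strands of the tree: the seat's Hodge–Riemann ∕ signature rows g61-#2, #4, #5 (imported:
`LefschetzPoincareTypeWeilFormSignature`) and the Weyl-operator rows g55-#6 ∕ g56-#1 of `LefschetzPrimitiveDecompositionInternal` ∕ `LefschetzModuleWeylOperatorDegreeZero`
(`w = (−1)ᵐ` on the middles `eᵐP_{−2m}`, `M₀ ∩ ker(w − 1) = ⨆_{m even} eᵐP_{−2m}`, `M₀ ∩ ker(w + 1) = ⨆_{m odd} eᵐP_{−2m}`, `tr(w|M₀) = Σ_m (−1)ᵐ dim P_{−2m}`)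
with p34's `LefschetzModuleWeylOperatorSelfAdjoint` (`w` is self-adjoint for a Poincaré-type pairing).  THE POINT: in the middle degree `M₀ = Hⁿ(X)` the Weyl
element `w = exp(f)exp(−e)exp(f)` (Beauville's Fourier transform `ℱ`, André's `± *_H`) is an involution whose `±1`-eigenspaces are exactly the sums of the
Lefschetz pieces `Lᵐ P^{n−2m}` with `m` even ∕ odd — the pieces on which the Hodge–Riemann relations prescribe the ALTERNATING signs `ε(−1)ᵐ` for the
Weil form `ψ(x, Cy)` — so the sign rule says precisely that `ψ(x, Cy)` is `ε`-definite on the `w`-invariants of `M₀` and `(−ε)`-definite on the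
anti-invariants (the module-level form of "the intersection form is definite of opposite signs on the self-dual and the anti-self-dual middle forms",
`w` playing the Hodge star: "`(0 1 ; −1 0) ∈ SL₂` s'envoie sur `± *_H`").  THEOREMS ONLY (no `def`, no named fact, no instance, no notation; D-0026 net debt `0`).

## Sources, VERBATIM

* Y. André, *Pour une théorie inconditionnelle des motifs*, Publ. Math. IHÉS 83 (1996) [Andre1996Motifs] (held `paper:doi-10-1007-bf02698643`, p. 11 = p0008):
  L5–L10 "Remarque. — Si `K ⊂ ℂ` et `H*` est la cohomologie de Betti, … l'opérateur star de Hodge relatif à une forme de Kähler représentant la classe `η` est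
  le conjugué complexe de … ; le point important, qui justifie l'introduction de `*_H` est que cet opérateur star et `*_H` ont les mêmes propriétés de
  positivité sur les cycles réels de type `(p,p)`."; L57–L59 "De plus, un calcul sans difficulté montre que l'élément `(0 1 ; −1 0)` de `SL₂` s'envoie sur
  `± *_H`, le signe étant `(−1)^{i(i+1)/2}` sur la composante `Hⁱ`."
* A. Beauville, *The action of SL₂ on abelian varieties* (2010) [Beauville2010SL2] (held `paper:arxiv-0805.1541`, §5 p0006 L10–L16): "Corollary. Let `P^p_s ⊂
  CH^p_s(A)` be the subspace of primitive elements. Then `CH^p_s(A) = ⊕_{q≤p} θ^{p−q} P^q_s`. Since the Fourier automorphism `ℱ` of `CH(A)` is given by the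
  action of `w`, we have: Corollary. Let `z ∈ CH^p_s(A)` be a primitive element, and let `q ≤ g+s−2p`. Then `ℱ(θ^q z/q!) = ((−θ)^r/r!) z`, with `r = g+s−2p−q`."
* M. A. de Cataldo, *The Hodge Theory of Projective Manifolds* (2007) [Decataldo2007] (held), §7.1 Def. 7.1.7 (p0049 L39–p0050 L1) ("`Ψ̃(x, y) := Ψ(x, C(y))` is
  symmetric and positive definite"), §7.3 Thm. 7.3.4 (b), (c) (p0052 L41–p0053 L9).
* C. Voisin, *Hodge Theory and Complex Algebraic Geometry I* (2002) [VoisinHodgeI2002] (held), §6.3.2 Prop. 6.29, Lemma 6.31, Thm. 6.32 (p0128 L1–p0129 L6).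
* J. S. Milne, *Polarizations and Grothendieck's standard conjectures*, Ann. of Math. 155 (2002) [Milne2002Polarizations] (held), §3 Prop. 3.2 (p0008 L40–p0009 L7)
  ((a) the `θ_r` positive definite ⟺ (b) the forms `⟨x · ∗y⟩` positive).
* J.-P. Serre, *Linear Representations of Finite Groups* (1977) [Serre1977] (held p0024), §2.6 Thm. 8 (canonical decomposition; the `±1`-eigenspaces of an involution).
* Th. Bröcker, T. tom Dieck, *Representations of Compact Lie Groups* (1985) [BrockerTomDieck1985] (held p0080), II §5 ("`−E` acts as multiplication by `(−1)ⁿ` on `V_n`").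
* D. J. H. Garling, *Clifford Algebras: An Introduction* (2011) [Garling2011] (held), §4.3 p0080 L19–L23.

## Dictionary

`(M, h, e)` Lefschetz (`L`, `hgr`), `w = L.weylOperator hgr`, `M₀ = degreeSpace h 0`, `V_± = M₀ ⊓ Module.End.eigenspace w (±1)`, `ψ` of Poincaré type (`hh`: `h` skew,
`he`: `e` self-adjoint), `C` with `[C, h] = [C, e] = 0` (`hCh`, `hCe`), the Weil form `ψ_C(x, y) = ψ(x, Cy)`, `Q₀ = (ψ.compl₂ C).restrict M₀` its restriction to
the middle degree, `m_k = dim P_{−k}`, `ε = ±1` an integer sign; the HODGE–RIEMANN SIGN RULE IN THE MIDDLE DEGREE `hHR : ∀ t, ∀ p ∈ P_{−2t} ∖ 0, 0 < ε(−1)ᵗ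
ψ(p, e^{2t}Cp)` (rows g61-#4 ∕ #5 at `j = 0`).

## What is proved

* §1 (any field of characteristic `0`) `apply_pow_weil_pow_eq` (`ψ(eᵗp, C eᵗq) = ψ(p, e^{2t}Cq)`), ★ `HasLefschetzProperty.apply_weylOperator_weylOperator_of_mem_degreeSpace_zero`
  (`w` is a `ψ`-isometry on `M₀`), ★★ **`….apply_weil_eq_zero_of_weylOperator_eq_of_eq_neg`** (`V₊ ⊥ V₋` for `ψ_C`: `wx = x`, `wy = −y` ⟹ `ψ(x, Cy) = 0`; `w` self-adjoint,
  `[C, w] = 0`, `2 ≠ 0`), `….apply_eq_zero_of_weylOperator_eq_of_eq_neg` (`C = 1`).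
* §2 (ordered field) ★★★ **`HasLefschetzProperty.weil_weylOperator_pos_of_hodgeRiemann`: `hHR` ⟹ `0 < ε ψ(x, C w x)` for every `x ∈ M₀ ∖ 0`** (`x = Σ_t eᵗp_t`,
  `wx = Σ_t (−1)ᵗ eᵗp_t`, cross terms vanish: `ψ(x, Cwx) = Σ_t (−1)ᵗ ψ(p_t, e^{2t}Cp_t)`), whence ★★★ **`….weil_pos_of_mem_eigenspace_weylOperator_one_of_hodgeRiemann`**
  (`0 < ε ψ(x, Cx)` on `V₊ ∖ 0`) and ★★★ **`….weil_neg_of_mem_eigenspace_weylOperator_neg_one_of_hodgeRiemann`** (`ε ψ(x, Cx) < 0` on `V₋ ∖ 0`), and the converse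
  ★★★ **`….hodgeRiemann_degreeSpace_zero_iff_weylOperator`**: `hHR ↔ (ε ψ_C > 0 on V₊ ∖ 0) ∧ (ε ψ_C < 0 on V₋ ∖ 0)`.
* §3 ★★★ **`HasLefschetzProperty.sigPos_sigNeg_weilForm_restrict_degreeSpace_zero_eq_finrank_of_hodgeRiemann`: `b⁺(Q₀) = dim(M₀ ∩ ker(w − ε))`, `b⁻(Q₀) = dim(M₀ ∩
  ker(w + ε))`** (row g61-#5 at `j = 0`: `b⁺ − b⁻ = ε Σ_t (−1)ᵗ m_{2t}`, `b⁺ + b⁻ = dim M₀`, against `dim V₊ = Σ_{t even} m_{2t}`, `dim V₋ = Σ_{t odd} m_{2t}`), ★★★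
  **`….signature_weilForm_restrict_degreeSpace_zero_eq_trace_weylOperator`: `b⁺(Q₀) − b⁻(Q₀) = ε · tr(w | M₀) = ε · tr(w)`** (in `K`).

## SCOPE

(a) Only the middle degree `M₀` (where `w² = 1`); on `M_m ⊕ M_{−m}`, `m ≠ 0`, `w` swaps the two pieces and `w² = (−1)ᵐ` (tree: `LefschetzModuleWeylOperatorDegreePairs`)
— not treated; (b) the identification of `w|_{M₀}` with `±` the Hodge star and of `ε` with the printed signs is the consumer's; (c) nothing here concerns the Hodge
conjecture.
-/

namespace Literature.Algebra.Lie

open Module Function Set Finset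
open LinearMap (BilinForm)
open HasLefschetzProperty (primitiveSpace mem_primitiveSpace_iff)

variable {K : Type*} [Field K] {M : Type*} [AddCommGroup M] [Module K M] {ψ : BilinForm K M} {h e C : Module.End K M}

/-! ### §1 `w` on `M₀`: a `ψ`-isometry; `V₊ ⊥ V₋` for the Weil form -/

/-- `ψ(eᵗp, C eᵗq) = ψ(p, e^{2t}Cq)` (`[C, e] = 0`, `e` self-adjoint): on the middle block `eᵗP_{−2t}` the Weil form IS the primitive form `ψ(p, e^{2t}Cq)`.
[cite: LooijengaLunts1997, §1 (1.6) p0005 L44–L48 ("e commutes with J"; "H^k_e(m, m′) := φ(eᵏm, Jm̄′)")] [cite: VoisinHodgeI2002, §6.3.2 Lemma 6.31 (p0128 L25–L35)] -/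
theorem apply_pow_weil_pow_eq (he : ψ.IsSelfAdjoint e) (hCe : Commute C e) (t : ℕ) (p q : M) :
    ψ ((e ^ t) p) (C ((e ^ t) q)) = ψ p ((e ^ (2 * t)) (C q)) := by
  rw [← Module.End.mul_apply C (e ^ t) q, (hCe.pow_right t).eq, Module.End.mul_apply, apply_pow_primitive_pow_primitive_eq he (show t + t = 2 * t by ring),
    apply_pow_weil_eq_pow_apply_weil he]

section AnyField

variable [CharZero K] [FiniteDimensional K M]

/-- ★ **`w` is a `ψ`-isometry on the middle degree: `ψ(wx, wy) = ψ(x, y)` for `y ∈ M₀`** (`w` is self-adjoint and `w² = 1` on `M₀`).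
[cite: Andre1996Motifs, §1.1–1.2 (p0008 L57–L59: "(0 1 ; −1 0) … s'envoie sur ± *_H"; *_H self-adjoint)] [cite: BrockerTomDieck1985, II §5 (p0080, "−E acts as multiplication by (−1)ⁿ on V_n")] -/
theorem HasLefschetzProperty.apply_weylOperator_weylOperator_of_mem_degreeSpace_zero (L : HasLefschetzProperty h e) (hgr : IsZGrading h)
    (hh : ψ.IsSkewAdjoint h) (he : ψ.IsSelfAdjoint e) (x : M) {y : M} (hy : y ∈ degreeSpace h 0) :
    ψ (L.weylOperator hgr x) (L.weylOperator hgr y) = ψ x y := by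
  rw [L.isSelfAdjoint_weylOperator hgr hh he x (L.weylOperator hgr y), L.weylOperator_weylOperator_apply_of_mem_degreeSpace_zero hgr hy]

/-- ★★ **`V₊ ⊥ V₋` FOR THE WEIL FORM: `wx = x`, `wy = −y` ⟹ `ψ(x, Cy) = 0`** (`[C, h] = [C, e] = 0`, so `[C, w] = 0`; `ψ(x, Cy) = ψ(wx, Cy) = ψ(x, wCy) = ψ(x, Cwy) =
−ψ(x, Cy)`) — the `w`-invariant and the `w`-anti-invariant middle classes are orthogonal, as the Lefschetz pieces they are made of (Thm. 7.3.4 (b)).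
[cite: Decataldo2007, §7.3 Thm. 7.3.4 (b) (p0052 L41–L46) ("all summands are mutually orthogonal")] [cite: Serre1977, §2.6 Thm. 8 (i) (p0024)] [cite: Andre1996Motifs, §1.2 (p0008 L57–L59)] -/
theorem HasLefschetzProperty.apply_weil_eq_zero_of_weylOperator_eq_of_eq_neg (L : HasLefschetzProperty h e) (hgr : IsZGrading h) (hh : ψ.IsSkewAdjoint h)
    (he : ψ.IsSelfAdjoint e) (hCh : Commute C h) (hCe : Commute C e) {x y : M} (hx : L.weylOperator hgr x = x) (hy : L.weylOperator hgr y = -y) :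
    ψ x (C y) = 0 := by
  have hCw : Commute C (L.weylOperator hgr) := L.commute_weylOperator hgr hCe (L.commute_dual_of_commute_pair hgr hCh hCe)
  have h1 : ψ (L.weylOperator hgr x) (C y) = -ψ x (C y) := by
    rw [L.isSelfAdjoint_weylOperator hgr hh he x (C y), ← Module.End.mul_apply (L.weylOperator hgr) C y, ← hCw.eq, Module.End.mul_apply, hy, map_neg,
      map_neg]
  rw [hx] at h1
  have h2 : (2 : K) * ψ x (C y) = 0 := by linear_combination h1
  exact (mul_eq_zero.1 h2).resolve_left two_ne_zero

/-- The case `C = 1`: `wx = x`, `wy = −y` ⟹ `ψ(x, y) = 0`. [cite: Serre1977, §2.6 Thm. 8 (i) (p0024)] [cite: Andre1996Motifs, §1.2 (p0008 L57–L59)] -/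
theorem HasLefschetzProperty.apply_eq_zero_of_weylOperator_eq_of_eq_neg (L : HasLefschetzProperty h e) (hgr : IsZGrading h) (hh : ψ.IsSkewAdjoint h)
    (he : ψ.IsSelfAdjoint e) {x y : M} (hx : L.weylOperator hgr x = x) (hy : L.weylOperator hgr y = -y) : ψ x y = 0 := by
  simpa only [Module.End.one_apply] using
    L.apply_weil_eq_zero_of_weylOperator_eq_of_eq_neg hgr hh he (Commute.one_left h) (Commute.one_left e) (C := 1) hx hy

end AnyField

/-! ### §2 Hodge–Riemann in the middle degree ⟺ `ψ_C` is `ε`-definite on `V₊` and `(−ε)`-definite on `V₋` -/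

section Ordered

variable [LinearOrder K] [IsStrictOrderedRing K] [FiniteDimensional K M]

/-- ★★★ **`hHR` ⟹ `0 < ε ψ(x, C w x)` for every non-zero `x ∈ M₀`**: writing `x = Σ_t eᵗp_t` (`p_t ∈ P_{−2t}`), `wx = Σ_t (−1)ᵗ eᵗp_t` (`w = (−1)ᵗ` on `eᵗP_{−2t}`) and the
cross terms vanish (Lemma 6.31), so `ψ(x, Cwx) = Σ_t (−1)ᵗ ψ(p_t, e^{2t}Cp_t)`, a sum of terms of sign `ε` (`hHR`), one of them non-zero.
[cite: VoisinHodgeI2002, §6.3.2 Lemma 6.31, Thm. 6.32 (p0128 L25–p0129 L6)] [cite: Beauville2010SL2, §5 Corollary (p0006 L10–L16) ("ℱ(θ^q z/q!) = ((−θ)^r/r!) z")] [cite: Andre1996Motifs, §1.2 (p0008 L57–L59)] -/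
theorem HasLefschetzProperty.weil_weylOperator_pos_of_hodgeRiemann (L : HasLefschetzProperty h e) (hgr : IsZGrading h) (he : ψ.IsSelfAdjoint e)
    (hCe : Commute C e) {ε : ℤ}
    (hHR : ∀ t : ℕ, ∀ p ∈ primitiveSpace h e (2 * t), p ≠ 0 → 0 < ((ε * (-1) ^ t : ℤ) : K) * ψ p ((e ^ (2 * t)) (C p))) {x : M}
    (hx : x ∈ degreeSpace h 0) (hx0 : x ≠ 0) : 0 < (ε : K) * ψ x (C (L.weylOperator hgr x)) := by
  obtain ⟨p, hp, rfl⟩ := L.exists_eq_sum_pow_primitive (n := finrank K M) (j := 0) (by omega) (x := x) (by simpa using hx)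
  have hp' : ∀ t : Fin (finrank K M), p t ∈ primitiveSpace h e (2 * (t : ℕ)) := fun t ↦ by simpa only [zero_add] using hp t
  have hq : ∀ t : Fin (finrank K M), ((-1 : K) ^ (t : ℕ)) • p t ∈ primitiveSpace h e (0 + 2 * (t : ℕ)) := fun t ↦ Submodule.smul_mem _ _ (hp t)
  -- `w x = Σ_t eᵗ ((−1)ᵗ p_t)`
  have hw : L.weylOperator hgr (∑ t : Fin (finrank K M), (e ^ (t : ℕ)) (p t)) = ∑ t : Fin (finrank K M), (e ^ (t : ℕ)) (((-1 : K) ^ (t : ℕ)) • p t) := by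
    rw [map_sum]
    refine sum_congr rfl fun t _ ↦ ?_
    rw [map_smul, L.weylOperator_apply_of_mem_map_pow_primitiveSpace_two_mul hgr ⟨p t, hp' t, rfl⟩]
  -- `ψ(x, Cwx) = Σ_t (−1)ᵗ ψ(p_t, e^{2t}Cp_t)`
  have hsum : ψ (∑ t : Fin (finrank K M), (e ^ (t : ℕ)) (p t)) (C (L.weylOperator hgr (∑ t : Fin (finrank K M), (e ^ (t : ℕ)) (p t)))) =
      ∑ t : Fin (finrank K M), (-1 : K) ^ (t : ℕ) * ψ (p t) ((e ^ (2 * (t : ℕ))) (C (p t))) := by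
    have h1 := apply_sum_pow_compl₂_pow_sum_pow (ψ := ψ.compl₂ C) (isSelfAdjoint_compl₂_of_commute he hCe) (j := 0) hp hq
    rw [pow_zero, Module.End.one_apply] at h1
    rw [hw, show ψ (∑ t : Fin (finrank K M), (e ^ (t : ℕ)) (p t)) (C (∑ t : Fin (finrank K M), (e ^ (t : ℕ)) (((-1 : K) ^ (t : ℕ)) • p t))) =
      (ψ.compl₂ C) (∑ t : Fin (finrank K M), (e ^ (t : ℕ)) (p t)) (∑ t : Fin (finrank K M), (e ^ (t : ℕ)) (((-1 : K) ^ (t : ℕ)) • p t)) from rfl, h1]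
    refine sum_congr rfl fun t _ ↦ ?_
    rw [primitiveForms_compl₂_apply hCe]
    simp only [zero_add, map_smul, smul_eq_mul]
  rw [hsum, mul_sum]
  have hterm : ∀ t : Fin (finrank K M), p t ≠ 0 → 0 < (ε : K) * ((-1 : K) ^ (t : ℕ) * ψ (p t) ((e ^ (2 * (t : ℕ))) (C (p t)))) := fun t ht ↦ by
    have h1 := hHR t (p t) (hp' t) ht
    push_cast at h1
    rwa [← mul_assoc]
  obtain ⟨t₀, ht₀⟩ : ∃ t, p t ≠ 0 := by
    by_contra hall
    exact hx0 (sum_eq_zero fun t _ ↦ by rw [not_not.1 (not_exists.1 hall t), map_zero])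
  refine sum_pos' (fun t _ ↦ ?_) ⟨t₀, mem_univ _, hterm t₀ ht₀⟩
  by_cases ht : p t = 0
  · simp [ht]
  · exact (hterm t ht).le

/-- ★★★ **THE WEIL FORM IS `ε`-DEFINITE ON THE `w`-INVARIANT MIDDLE CLASSES: `x ∈ M₀ ∩ ker(w − 1)`, `x ≠ 0` ⟹ `0 < ε ψ(x, Cx)`** (= `ε ψ(x, Cwx)`). In geometry:
`ψ(x, Cx)` is definite on the middle classes fixed by `± *` — the sum of the Lefschetz pieces `Lᵐ P^{n−2m}`, `m` even, where the Hodge–Riemann signs agree.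
[cite: Decataldo2007, §7.1 Def. 7.1.7 and §7.3 Thm. 7.3.4 (c) (p0049 L39–p0050 L1, p0053 L1–L9)] [cite: VoisinHodgeI2002, §6.3.2 Thm. 6.32 (p0128 L36–p0129 L6)]
[cite: Andre1996Motifs, §1.1 Remarque and §1.2 (p0008 L5–L10, L57–L59)] -/
theorem HasLefschetzProperty.weil_pos_of_mem_eigenspace_weylOperator_one_of_hodgeRiemann (L : HasLefschetzProperty h e) (hgr : IsZGrading h)
    (he : ψ.IsSelfAdjoint e) (hCe : Commute C e) {ε : ℤ}
    (hHR : ∀ t : ℕ, ∀ p ∈ primitiveSpace h e (2 * t), p ≠ 0 → 0 < ((ε * (-1) ^ t : ℤ) : K) * ψ p ((e ^ (2 * t)) (C p))) {x : M}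
    (hx : x ∈ degreeSpace h 0 ⊓ Module.End.eigenspace (L.weylOperator hgr) 1) (hx0 : x ≠ 0) : 0 < (ε : K) * ψ x (C x) := by
  obtain ⟨hx₀, hx₁⟩ := Submodule.mem_inf.1 hx
  have hwx : L.weylOperator hgr x = x := by rw [Module.End.mem_eigenspace_iff.1 hx₁, one_smul]
  have h1 := L.weil_weylOperator_pos_of_hodgeRiemann hgr he hCe hHR hx₀ hx0
  rwa [hwx] at h1

/-- ★★★ **… AND `(−ε)`-DEFINITE ON THE ANTI-INVARIANT ONES: `x ∈ M₀ ∩ ker(w + 1)`, `x ≠ 0` ⟹ `ε ψ(x, Cx) < 0`** (the Lefschetz pieces `Lᵐ P^{n−2m}`, `m` odd).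
[cite: Decataldo2007, §7.3 Thm. 7.3.4 (c) (p0053 L1–L9)] [cite: VoisinHodgeI2002, §6.3.2 Thm. 6.32 (p0128 L36–p0129 L6)] [cite: Andre1996Motifs, §1.2 (p0008 L57–L59)] -/
theorem HasLefschetzProperty.weil_neg_of_mem_eigenspace_weylOperator_neg_one_of_hodgeRiemann (L : HasLefschetzProperty h e) (hgr : IsZGrading h)
    (he : ψ.IsSelfAdjoint e) (hCe : Commute C e) {ε : ℤ}
    (hHR : ∀ t : ℕ, ∀ p ∈ primitiveSpace h e (2 * t), p ≠ 0 → 0 < ((ε * (-1) ^ t : ℤ) : K) * ψ p ((e ^ (2 * t)) (C p))) {x : M}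
    (hx : x ∈ degreeSpace h 0 ⊓ Module.End.eigenspace (L.weylOperator hgr) (-1)) (hx0 : x ≠ 0) : (ε : K) * ψ x (C x) < 0 := by
  obtain ⟨hx₀, hx₁⟩ := Submodule.mem_inf.1 hx
  have hwx : L.weylOperator hgr x = -x := by rw [Module.End.mem_eigenspace_iff.1 hx₁, neg_one_smul]
  have h1 := L.weil_weylOperator_pos_of_hodgeRiemann hgr he hCe hHR hx₀ hx0
  rw [hwx, map_neg, map_neg, mul_neg] at h1
  exact neg_pos.1 h1

omit [LinearOrder K] [IsStrictOrderedRing K] [FiniteDimensional K M] in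
/-- `eᵗp ≠ 0` for non-zero `p ∈ P_{−2t}` (`eᵗ` is injective on `P_{−2t} ⊆ M_{−2t}`, `t ≤ 2t`). [cite: LooijengaLunts1997, §1 (1.1) p0004 L1–L4 ("eᵏ maps M_{−k} isomorphically onto M_k")] -/
private theorem pow_apply_ne_zero_of_mem_primitiveSpace₈₆ [CharZero K] (L : HasLefschetzProperty h e) {t : ℕ} {p : M} (hp : p ∈ primitiveSpace h e (2 * t))
    (hp0 : p ≠ 0) : (e ^ t) p ≠ 0 := by
  intro h0
  refine hp0 (L.eq_zero_of_pow_apply_eq_zero (n := ((2 * t : ℕ) : ℤ)) (by positivity) (mem_primitiveSpace_iff.1 hp).1 ?_)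
  rw [Int.toNat_natCast, show 2 * t = t + t by ring, pow_add, Module.End.mul_apply, h0, map_zero]

/-- ★★★ **HODGE–RIEMANN IN THE MIDDLE DEGREE ⟺ DEFINITENESS ON THE WEYL EIGENSPACES: `hHR ↔ (0 < ε ψ(x, Cx) on V₊ ∖ 0) ∧ (ε ψ(x, Cx) < 0 on V₋ ∖ 0)`** (`V_± =
M₀ ∩ ker(w ∓ 1)`; ⟸: `p ∈ P_{−2t} ∖ 0` gives `x = eᵗp ∈ V_{(−1)ᵗ} ∖ 0` with `ψ(x, Cx) = ψ(p, e^{2t}Cp)`).  With `w ↦ ± *` this is the classical reading of the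
Hodge–Riemann relations in the middle degree as the definiteness of `Q(x, Cy)` on the (anti-)self-dual classes, with opposite signs.
[cite: Andre1996Motifs, §1.1 Remarque and §1.2 (p0008 L5–L10, L57–L59)] [cite: Decataldo2007, §7.1 Def. 7.1.7 and §7.3 Thm. 7.3.4 (b), (c) (p0049 L39–p0050 L1, p0052 L41–p0053 L9)]
[cite: VoisinHodgeI2002, §6.3.2 Prop. 6.29, Thm. 6.32 (p0128 L1–p0129 L6)] [cite: Milne2002Polarizations, §3 Prop. 3.2 (a) ⟺ (b) (p0008 L40–p0009 L7)] -/
theorem HasLefschetzProperty.hodgeRiemann_degreeSpace_zero_iff_weylOperator (L : HasLefschetzProperty h e) (hgr : IsZGrading h) (he : ψ.IsSelfAdjoint e)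
    (hCe : Commute C e) (ε : ℤ) :
    (∀ t : ℕ, ∀ p ∈ primitiveSpace h e (2 * t), p ≠ 0 → 0 < ((ε * (-1) ^ t : ℤ) : K) * ψ p ((e ^ (2 * t)) (C p))) ↔
      (∀ x ∈ degreeSpace h 0 ⊓ Module.End.eigenspace (L.weylOperator hgr) 1, x ≠ 0 → 0 < (ε : K) * ψ x (C x)) ∧
        ∀ x ∈ degreeSpace h 0 ⊓ Module.End.eigenspace (L.weylOperator hgr) (-1), x ≠ 0 → (ε : K) * ψ x (C x) < 0 := by
  refine ⟨fun hHR ↦ ⟨fun x hx hx0 ↦ L.weil_pos_of_mem_eigenspace_weylOperator_one_of_hodgeRiemann hgr he hCe hHR hx hx0,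
    fun x hx hx0 ↦ L.weil_neg_of_mem_eigenspace_weylOperator_neg_one_of_hodgeRiemann hgr he hCe hHR hx hx0⟩, fun H t p hp hp0 ↦ ?_⟩
  obtain ⟨Hp, Hm⟩ := H
  have hx : (e ^ t) p ∈ (primitiveSpace h e (2 * t)).map (e ^ t) := ⟨p, hp, rfl⟩
  have hx0 := pow_apply_ne_zero_of_mem_primitiveSpace₈₆ L hp hp0
  have hM0 := L.map_pow_primitiveSpace_two_mul_le_degreeSpace_zero t hx
  have hev := L.map_pow_primitiveSpace_two_mul_le_eigenspace_weylOperator hgr t hx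
  have hval : ψ ((e ^ t) p) (C ((e ^ t) p)) = ψ p ((e ^ (2 * t)) (C p)) := apply_pow_weil_pow_eq he hCe t p p
  rcases Nat.even_or_odd t with ht | ht
  · rw [ht.neg_one_pow] at hev
    have h1 := Hp _ (Submodule.mem_inf.2 ⟨hM0, hev⟩) hx0
    rw [hval] at h1
    push_cast
    rwa [ht.neg_one_pow, mul_one]
  · rw [ht.neg_one_pow] at hev
    have h1 := Hm _ (Submodule.mem_inf.2 ⟨hM0, hev⟩) hx0
    rw [hval] at h1
    push_cast
    rw [ht.neg_one_pow, mul_neg_one, neg_mul]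
    exact neg_pos.2 h1

/-! ### §3 `b^±(ψ_C|_{M₀})` are the dimensions of the Weyl eigenspaces; the index is `ε · tr(w | M₀)` -/

omit [IsStrictOrderedRing K] [FiniteDimensional K M] in
/-- `b^±` of the restrictions of one form to EQUAL submodules agree. [folklore] -/
private theorem sigPos_sigNeg_restrict_congr₈₆ {W W' : Submodule K M} (hW : W = W') (B : BilinForm K M) :
    sigPos (LinearMap.BilinForm.restrict B W).toQuadraticMap = sigPos (LinearMap.BilinForm.restrict B W').toQuadraticMap ∧
      sigNeg (LinearMap.BilinForm.restrict B W).toQuadraticMap = sigNeg (LinearMap.BilinForm.restrict B W').toQuadraticMap := by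
  subst hW
  exact ⟨rfl, rfl⟩

/-- `Σ_{t<D} (−1)ᵗ m_{2t} = Σ_{t<D, t even} m_{2t} − Σ_{t<D, t odd} m_{2t}` (in `ℤ`). [folklore] -/
private theorem sum_neg_one_pow_mul_eq_sub₈₆ (D : ℕ) (s : ℕ → ℕ) :
    ∑ t ∈ range D, (-1 : ℤ) ^ t * (s t : ℤ) = (∑ t ∈ (range D).filter Even, (s t : ℤ)) - ∑ t ∈ (range D).filter Odd, (s t : ℤ) := by
  rw [← sum_filter_add_sum_filter_not (range D) Even, sub_eq_add_neg, ← sum_neg_distrib]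
  congr 1
  · exact sum_congr rfl fun t ht ↦ by rw [((mem_filter.1 ht).2 : Even t).neg_one_pow, one_mul]
  · refine sum_congr (filter_congr fun t _ ↦ Nat.not_even_iff_odd) fun t ht ↦ ?_
    rw [((mem_filter.1 ht).2 : Odd t).neg_one_pow, neg_one_mul]

/-- The two counts of row g61-#5 at `j = 0`, transported to `Q₀ = (ψ.compl₂ C)|_{M₀}` and to the Weyl eigenspaces: `b⁺ + b⁻ = dim V₊ + dim V₋` and `b⁺ − b⁻ =
ε (dim V₊ − dim V₋)`. [cite: VoisinHodgeI2002, §6.3.2 Thm. 6.33 proof (p0129 L19–L32)] [cite: BrockerTomDieck1985, II §5 (p0080)] -/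
private theorem sig_counts₈₆ (L : HasLefschetzProperty h e) (hgr : IsZGrading h) (he : ψ.IsSelfAdjoint e) (hCe : Commute C e) {ε : ℤ} (hε : ε = 1 ∨ ε = -1)
    (hHR : ∀ t : ℕ, ∀ p ∈ primitiveSpace h e (2 * t), p ≠ 0 → 0 < ((ε * (-1) ^ t : ℤ) : K) * ψ p ((e ^ (2 * t)) (C p))) :
    (sigPos (LinearMap.BilinForm.restrict (ψ.compl₂ C) (degreeSpace h 0)).toQuadraticMap : ℤ) +
          sigNeg (LinearMap.BilinForm.restrict (ψ.compl₂ C) (degreeSpace h 0)).toQuadraticMap =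
        (finrank K ↥(degreeSpace h 0 ⊓ Module.End.eigenspace (L.weylOperator hgr) 1) : ℤ) +
          finrank K ↥(degreeSpace h 0 ⊓ Module.End.eigenspace (L.weylOperator hgr) (-1)) ∧
      (sigPos (LinearMap.BilinForm.restrict (ψ.compl₂ C) (degreeSpace h 0)).toQuadraticMap : ℤ) -
          sigNeg (LinearMap.BilinForm.restrict (ψ.compl₂ C) (degreeSpace h 0)).toQuadraticMap =
        ε * ((finrank K ↥(degreeSpace h 0 ⊓ Module.End.eigenspace (L.weylOperator hgr) 1) : ℤ) -
          finrank K ↥(degreeSpace h 0 ⊓ Module.End.eigenspace (L.weylOperator hgr) (-1))) := by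
  have hHR' : ∀ t : ℕ, ∀ p ∈ primitiveSpace h e (0 + 2 * t), p ≠ 0 → 0 < ((ε * (-1) ^ t : ℤ) : K) * ψ p ((e ^ (0 + 2 * t)) (C p)) := by
    simpa only [zero_add] using hHR
  have hn : finrank K M ≤ 0 + 2 * finrank K M := by omega
  have h1 := L.signature_weilForm_restrict_compl₂_pow_of_hodgeRiemann he hCe hn hε hHR'
  have h2 := L.sigPos_add_sigNeg_weilForm_restrict_compl₂_pow_of_hodgeRiemann he hCe hn hε hHR'
  obtain ⟨hp, hm⟩ := sigPos_sigNeg_restrict_congr₈₆ (show degreeSpace h (-((0 : ℕ) : ℤ)) = degreeSpace h 0 by rw [Nat.cast_zero, neg_zero])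
    ((ψ.compl₂ C).compl₂ (e ^ 0))
  rw [hp, hm, pow_zero, Module.End.one_eq_id, LinearMap.compl₂_id] at h1 h2
  rw [Nat.cast_zero, neg_zero] at h2
  have hz : ∀ t : ℕ, (finrank K ↥(primitiveSpace h e (0 + 2 * t)) : ℤ) = finrank K ↥(primitiveSpace h e (2 * t)) := fun t ↦ by rw [zero_add]
  simp_rw [hz] at h1
  rw [sum_neg_one_pow_mul_eq_sub₈₆] at h1
  refine ⟨?_, ?_⟩
  · rw [← Nat.cast_add, ← Nat.cast_add, h2, L.finrank_degreeSpace_zero_inf_eigenspace_weylOperator_one_add_neg_one hgr]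
  · rw [h1, L.finrank_degreeSpace_zero_inf_eigenspace_weylOperator_one hgr, L.finrank_degreeSpace_zero_inf_eigenspace_weylOperator_neg_one hgr]
    push_cast
    ring

/-- ★★★ **`b⁺(ψ_C|_{M₀}) = dim(M₀ ∩ ker(w − ε))`, `b⁻(ψ_C|_{M₀}) = dim(M₀ ∩ ker(w + ε))`** (`ε = ±1`): under the Hodge–Riemann sign rule the indices of inertia of the
Weil form on the middle degree are the dimensions of the Weyl (Fourier) eigenspaces — `ε = 1`: `b⁺ = Σ_{t even} m_{2t} = dim V₊`, `b⁻ = Σ_{t odd} m_{2t} = dim V₋`.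
[cite: VoisinHodgeI2002, §6.3.2 Thm. 6.33 proof (p0129 L19–L32)] [cite: Beauville2010SL2, §5 Corollary (p0006 L10–L16)] [cite: BrockerTomDieck1985, II §5 (p0080)]
[cite: Serre1977, §2.6 Thm. 8 (ii) (p0024)] [cite: Garling2011, §4.3 p0080 L19–L23] -/
theorem HasLefschetzProperty.sigPos_sigNeg_weilForm_restrict_degreeSpace_zero_eq_finrank_of_hodgeRiemann (L : HasLefschetzProperty h e)
    (hgr : IsZGrading h) (he : ψ.IsSelfAdjoint e) (hCe : Commute C e) {ε : ℤ} (hε : ε = 1 ∨ ε = -1)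
    (hHR : ∀ t : ℕ, ∀ p ∈ primitiveSpace h e (2 * t), p ≠ 0 → 0 < ((ε * (-1) ^ t : ℤ) : K) * ψ p ((e ^ (2 * t)) (C p))) :
    sigPos (LinearMap.BilinForm.restrict (ψ.compl₂ C) (degreeSpace h 0)).toQuadraticMap =
        finrank K ↥(degreeSpace h 0 ⊓ Module.End.eigenspace (L.weylOperator hgr) ((ε : ℤ) : K)) ∧
      sigNeg (LinearMap.BilinForm.restrict (ψ.compl₂ C) (degreeSpace h 0)).toQuadraticMap =
        finrank K ↥(degreeSpace h 0 ⊓ Module.End.eigenspace (L.weylOperator hgr) (-((ε : ℤ) : K))) := by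
  obtain ⟨h1, h2⟩ := sig_counts₈₆ L hgr he hCe hε hHR
  rcases hε with rfl | rfl
  · rw [Int.cast_one]
    constructor <;> omega
  · rw [Int.cast_neg, Int.cast_one, neg_neg]
    constructor <;> omega

/-- ★★★ **THE INDEX OF THE WEIL FORM ON THE MIDDLE DEGREE IS `ε` TIMES THE TRACE OF THE WEYL ELEMENT: `b⁺(ψ_C|_{M₀}) − b⁻(ψ_C|_{M₀}) = ε · tr(w | M₀) = ε · tr(w)`**
(in `K`; `tr(w|M₀) = dim V₊ − dim V₋ = Σ_t (−1)ᵗ m_{2t} = tr w`, the trace of `w` living on `M₀` alone).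
[cite: Andre1996Motifs, §1.2 (p0008 L57–L59) ("(0 1 ; −1 0) … ± *_H, le signe étant (−1)^{i(i+1)/2} sur la composante Hⁱ")] [cite: BrockerTomDieck1985, II §5 (p0080)]
[cite: VoisinHodgeI2002, §6.3.2 Thm. 6.33 (p0129 L8–L32)] [cite: Serre1977, §2.1 Exercise 2.2 and §2.6 Thm. 8 (ii)] -/
theorem HasLefschetzProperty.signature_weilForm_restrict_degreeSpace_zero_eq_trace_weylOperator (L : HasLefschetzProperty h e) (hgr : IsZGrading h)
    (he : ψ.IsSelfAdjoint e) (hCe : Commute C e) {ε : ℤ} (hε : ε = 1 ∨ ε = -1)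
    (hHR : ∀ t : ℕ, ∀ p ∈ primitiveSpace h e (2 * t), p ≠ 0 → 0 < ((ε * (-1) ^ t : ℤ) : K) * ψ p ((e ^ (2 * t)) (C p))) :
    (sigPos (LinearMap.BilinForm.restrict (ψ.compl₂ C) (degreeSpace h 0)).toQuadraticMap : K) -
          sigNeg (LinearMap.BilinForm.restrict (ψ.compl₂ C) (degreeSpace h 0)).toQuadraticMap =
        (ε : K) * LinearMap.trace K ↥(degreeSpace h 0) ((L.weylOperator hgr).restrict (L.weylOperator_mapsTo_degreeSpace_zero hgr)) ∧
      (sigPos (LinearMap.BilinForm.restrict (ψ.compl₂ C) (degreeSpace h 0)).toQuadraticMap : K) -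
          sigNeg (LinearMap.BilinForm.restrict (ψ.compl₂ C) (degreeSpace h 0)).toQuadraticMap =
        (ε : K) * LinearMap.trace K M (L.weylOperator hgr) := by
  rw [← L.trace_weylOperator_restrict_degreeSpace_zero hgr, and_self, L.trace_weylOperator_restrict_degreeSpace_zero_eq_finrank_sub_finrank hgr]
  obtain ⟨-, h2⟩ := sig_counts₈₆ L hgr he hCe hε hHR
  have h3 := congrArg (fun z : ℤ ↦ (z : K)) h2
  push_cast at h3
  rw [h3]

end Ordered

end Literature.Algebra.Lie
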